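import Summits.ResolutionOfSingularities.ResolutionOfSingularities.Theorems.EquisingularLiftEquisingularLiftNatStrictTransformSquarefree
import Summits.ResolutionOfSingularities.ResolutionOfSingularities.Theorems.EquisingularLiftEquisingularLiftNatClusterLift
import Mathlib
import HarnessLib

/-!
# [OURS · L1 W4.5(b) · EL♮(3)] T-ΔLIFT-CLUSTER-SQF — the strict transform of a REDUCED plane trace at a GENERAL point of EXACT multiplicity is
# square-free, hence Δ4-finite: discharge of `hfinst` in res-L1-w45b-stub-3's T-CLUSTER-LIFT part 9 (crux `EquisingularLiftNatThree` =
# stmt-ResolutionOfSingularities-20148, parent stmt-20038; rung v7′ (TC⁺⁺), TCPP-SUPPLIER-MAP §3.1 / §5 (β))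

NOT a statement of any manuscript. Helper file of the chain res-L1-w45b (cell `res-hironaka`, rung L, slot W4.5(b)); AI-written, weaker than expert
review; filed `--supports stmt-ResolutionOfSingularities-20148 --as helper`; it closes nothing.

WHERE IT SITS. res-L1-w45b-stub-3's `exists_isHomogeneous_clusterLift_deltaRegular_stCharts` (…NatClusterLiftStrictTransformCharts, p531761) reads the
strict transform of `g(T_{i t} := 1)` on the `p`-chart of the blow-up of the cluster point `a_t` through the substitution
`B_{a,p} = β_p ∘ sh_a` (`sh_a : X ↦ X + a`, then stub-4's `β_p : X_p ↦ X_p, X_j ↦ X_p X_j`): `X_p^{m t} · gst t p = B_{a_t,p}(g(T_{i t} := 1))`, and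
takes as HYPOTHESIS `hfinst` that the bad set `{𝔮 | gst ∈ 𝔮, gst ∈ 𝔪_𝔮²}` is finite. This file proves it from what `FatCluster` / `ReducedConeForm`
(…NatClusterStepDefs) hold downstairs: the trace is reduced on the chart (`Squarefree (dehomogenize i g)`, or `(g(T_i := 1))` radical) and the order
of `g(T_i := 1)` at `a` is EXACTLY `m` (`∉ 𝔪_a^{m+1}`) — the general-point form of stub-4's …NatStrictTransformSquarefree (p525610, point `[1:0:0]`).

CONTENT (pure commutative algebra; `τ` any index type, `R`/`k` as stated).
* `aeval_blowupSubst_monomial`, `blowupExponent_injective`, `coeff_aeval_blowupSubst` — `β_p` on monomials: `X^α ↦ X^{ψ α}`,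
  `ψ α = α.erase p + single p |α|`, injective, so `coeff_{ψ α}(β_p f) = coeff_α f`.
* `mem_pow_idealOfVars_of_X_pow_dvd_aeval_blowupSubst` — the CONVERSE of stub-3's `aeval_blowupSubst_mem_span_X_pow`: `X_p^n ∣ β_p f ⇒ f ∈ 𝔪₀^n`.
* `not_X_dvd_of_not_mem_pow_succ` — exact order `m` at the origin forces `X_p ∤ gst` (`X_p^m · gst = β_p f`, `f ∉ 𝔪₀^{m+1}`).
* `squarefree_aeval_X_add_C` — translations preserve square-freeness.
* **`squarefree_strictTransform_shift`**, **`finite_setOf_mem_sq_strictTransform_shift`** — HEADLINE in part 9's binders (`i : Fin 3`,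
  `a : {j // j ≠ i} → k`, `p`, `m`, `g`, `gst`, `hgst`): `gst ≠ 0 ∧ X_p ∤ gst ∧ Squarefree gst`, hence `hfinst` (res-type-032 `finite_setOf_mem_sq_chart`);
  `…_of_isRadical` — the same from `(g(T_i := 1))` radical (`ReducedConeForm` (R2)).

References: folklore (unique factorisation in `k[X, Y]`); H. Matsumura, *Commutative Ring Theory* (1986), Thm. 14.2 (Δ-criterion context, index
only). OURS planning texts (index only): res-L1-w45b-stub-3 TCPP-SUPPLIER-MAP 9b18d88e22dffab2, STATUS 2026-08-27T12:33:19Z.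
-/

set_option linter.dupNamespace false -- mandated namespace `Summit.<Summit>.<Problem>` of this single-conjunct summit

noncomputable section

namespace Summit.ResolutionOfSingularities.ResolutionOfSingularities.Cruxes.EquisingularLiftNat.Sections

open MvPolynomial IsLocalRing Literature.AlgebraicGeometry.Resolution
open Summit.ResolutionOfSingularities.ResolutionOfSingularities.Theorems.EquisingularLiftNat.ClusterLift

universe u v

/-! ## `β_p` on monomials and coefficients -/

section Monomial

variable {R : Type u} [CommRing R] {τ : Type v} [DecidableEq τ] (p : τ)

/-- `β_p (c X^α) = c X^{ψ α}` with `ψ α = α.erase p + single p |α|` (`X_p ↦ X_p`, `X_j ↦ X_p X_j` collects `X_p^{|α|}`). [folklore] -/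
theorem aeval_blowupSubst_monomial (α : τ →₀ ℕ) (c : R) :
    aeval (fun j => if j = p then (X p : MvPolynomial τ R) else X p * X j) (monomial α c) =
      monomial (α.erase p + Finsupp.single p α.degree) c := by
  classical
  rw [aeval_monomial, algebraMap_eq, monomial_eq]
  congr 1
  -- both sides as products over the support
  have h1 : (α.prod fun j e => (if j = p then (X p : MvPolynomial τ R) else X p * X j) ^ e) =
      X p ^ α.degree * (α.erase p).prod fun j e => (X j : MvPolynomial τ R) ^ e := by
    conv_lhs => rw [← Finsupp.erase_add_single p α]
    rw [Finsupp.prod_add_index' (h := fun j e => (if j = p then (X p : MvPolynomial τ R) else X p * X j) ^ e)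
      (fun _ => pow_zero _) (fun _ _ _ => pow_add _ _ _),
      Finsupp.prod_single_index (h := fun j e => (if j = p then (X p : MvPolynomial τ R) else X p * X j) ^ e)
      (pow_zero _), if_pos rfl]
    have h2 : ((α.erase p).prod fun j e => (if j = p then (X p : MvPolynomial τ R) else X p * X j) ^ e) =
        (α.erase p).prod fun j e => (X p : MvPolynomial τ R) ^ e * X j ^ e := by
      refine Finsupp.prod_congr fun j hj => ?_
      have hjp : j ≠ p := by
        intro h; subst h
        rw [Finsupp.mem_support_iff, Finsupp.erase_same] at hj
        exact hj rfl
      rw [if_neg hjp, mul_pow]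
    rw [h2, Finsupp.prod_mul]
    have hpow : ((α.erase p).prod fun _ e => (X p : MvPolynomial τ R) ^ e) = X p ^ (α.erase p).degree := by
      rw [Finsupp.prod, Finset.prod_pow_eq_pow_sum, Finsupp.degree_apply]
    rw [hpow]
    have hdeg : α.degree = (α.erase p).degree + α p := by
      conv_lhs => rw [← Finsupp.erase_add_single p α]
      rw [map_add, Finsupp.degree_single]
    rw [hdeg, pow_add]
    ring
  rw [h1, Finsupp.prod_add_index' (h := fun j e => (X j : MvPolynomial τ R) ^ e) (fun _ => pow_zero _)
    (fun _ _ _ => pow_add _ _ _), Finsupp.prod_single_index (h := fun j e => (X j : MvPolynomial τ R) ^ e) (pow_zero _),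
    mul_comm]

omit [CommRing R] [DecidableEq τ] in
/-- The exponent map `ψ α = α.erase p + single p |α|` of `β_p` is injective. [folklore] -/
theorem blowupExponent_injective :
    Function.Injective fun α : τ →₀ ℕ => α.erase p + Finsupp.single p α.degree := by
  intro α α' h
  simp only at h
  have herase : α.erase p = α'.erase p := by
    have := congrArg (Finsupp.erase p) h
    rwa [Finsupp.erase_add, Finsupp.erase_add, Finsupp.erase_single, Finsupp.erase_single, add_zero, add_zero,
      Finsupp.erase_idem, Finsupp.erase_idem] at this
  have hdeg : α.degree = α'.degree := by
    have := DFunLike.congr_fun h p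
    simpa only [Finsupp.coe_add, Pi.add_apply, Finsupp.erase_same, zero_add, Finsupp.single_eq_same] using this
  have hp : α p = α' p := by
    have e1 : α.degree = (α.erase p).degree + α p := by
      conv_lhs => rw [← Finsupp.erase_add_single p α]
      rw [map_add, Finsupp.degree_single]
    have e2 : α'.degree = (α'.erase p).degree + α' p := by
      conv_lhs => rw [← Finsupp.erase_add_single p α']
      rw [map_add, Finsupp.degree_single]
    rw [herase] at e1
    omega
  rw [← Finsupp.erase_add_single p α, ← Finsupp.erase_add_single p α', herase, hp]

/-- **Coefficients under `β_p`**: `coeff_{ψ α}(β_p f) = coeff_α f`. [folklore] [OURS · L1 W4.5b] -/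
theorem coeff_aeval_blowupSubst (f : MvPolynomial τ R) (α : τ →₀ ℕ) :
    coeff (α.erase p + Finsupp.single p α.degree)
      (aeval (fun j => if j = p then (X p : MvPolynomial τ R) else X p * X j) f) = coeff α f := by
  classical
  conv_lhs => rw [f.as_sum, map_sum]
  simp_rw [aeval_blowupSubst_monomial, coeff_sum, coeff_monomial]
  rw [Finset.sum_eq_single α]
  · rw [if_pos rfl]
  · intro β _ hne
    rw [if_neg]
    exact fun h => hne (blowupExponent_injective p h)
  · intro h
    rw [if_pos rfl]
    exact (notMem_support_iff.mp h)

/-- **The converse of `aeval_blowupSubst_mem_span_X_pow`**: if `X_p^n` divides `β_p f`, then `f ∈ 𝔪₀^n` (every monomial of `f` has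
degree `≥ n`, its image under `β_p` carrying `X_p^{deg}`). [folklore] [OURS · L1 W4.5b] -/
theorem mem_pow_idealOfVars_of_X_pow_dvd_aeval_blowupSubst {n : ℕ} {f : MvPolynomial τ R}
    (h : (X p : MvPolynomial τ R) ^ n ∣ aeval (fun j => if j = p then (X p : MvPolynomial τ R) else X p * X j) f) :
    f ∈ idealOfVars τ R ^ n := by
  classical
  rw [mem_pow_idealOfVars_iff]
  intro α hα
  obtain ⟨G, hG⟩ := h
  have hc := coeff_aeval_blowupSubst p f α
  rw [hG, X_pow_eq_monomial, coeff_monomial_mul'] at hc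
  by_contra hlt
  rw [if_neg] at hc
  · exact (mem_support_iff.mp hα) hc.symm
  · rw [Finsupp.single_le_iff]
    simp only [Finsupp.coe_add, Pi.add_apply, Finsupp.erase_same, zero_add, Finsupp.single_eq_same]
    exact hlt

/-- **Exact order forces `X_p ∤ gst`.** If `X_p^m · gst = β_p f` and `f ∉ 𝔪₀^{m+1}` then `X_p ∤ gst`. [folklore] [OURS · L1 W4.5b] -/
theorem not_X_dvd_of_not_mem_pow_succ {m : ℕ} {f gst : MvPolynomial τ R} (hf : f ∉ idealOfVars τ R ^ (m + 1))
    (hgst : (X p : MvPolynomial τ R) ^ m * gst = aeval (fun j => if j = p then (X p : MvPolynomial τ R) else X p * X j) f) :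
    ¬ X p ∣ gst := by
  rintro ⟨w, rfl⟩
  apply hf
  refine mem_pow_idealOfVars_of_X_pow_dvd_aeval_blowupSubst p ⟨w, ?_⟩
  rw [← hgst, pow_succ, mul_assoc]

end Monomial

/-! ## Translations preserve square-freeness -/

section Shift

variable {R : Type u} [CommRing R] {τ : Type v}

/-- **`f` square-free ⇒ `f(X + a)` square-free** (the shift is a ring automorphism with inverse `X ↦ X − a`). [folklore] -/
theorem squarefree_aeval_X_add_C (a : τ → R) {f : MvPolynomial τ R} (hf : Squarefree f) :
    Squarefree (aeval (fun l : τ => (X l : MvPolynomial τ R) + C (a l)) f) := by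
  let e : MvPolynomial τ R ≃+* MvPolynomial τ R :=
    { toFun := aeval (fun l : τ => (X l : MvPolynomial τ R) + C (a l))
      invFun := aeval (fun l : τ => (X l : MvPolynomial τ R) - C (a l))
      left_inv := fun g => aeval_X_sub_C_aeval_X_add_C a g
      right_inv := fun g => aeval_X_add_C_aeval_X_sub_C a g
      map_mul' := fun x y => map_mul _ x y
      map_add' := fun x y => map_add _ x y }
  exact squarefree_map_of_mulEquiv e.toMulEquiv hf

end Shift

/-! ## HEADLINE: the strict transform at a general point of exact multiplicity is square-free, hence Δ4-finite -/

section General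

variable {k : Type} [Field k]

/-- **The strict transform of a reduced plane trace at a GENERAL point of EXACT multiplicity is square-free.** `i : Fin 3` the chart,
`a` a point of the chart, `p` the chart direction of the blow-up, `m` the order: if `g(T_i := 1)` is square-free and `∉ 𝔪_a^{m+1}`, and
`X_p^m · gst = β_p(g(T_i := 1)(X + a))` (res-L1-w45b-stub-3's `hgst`), then `gst ≠ 0`, `X_p ∤ gst` and `Squarefree gst`.
[folklore] [OURS · L1 W4.5b] -/
theorem squarefree_strictTransform_shift (i : Fin 3) (a : {j : Fin 3 // j ≠ i} → k) (p : {j : Fin 3 // j ≠ i}) {m : ℕ}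
    {g : MvPolynomial (Fin 3) k} (hsq : Squarefree (dehomogenize i g))
    (hexact : dehomogenize i g ∉
      (Ideal.span (Set.range fun j => (X j : MvPolynomial {j : Fin 3 // j ≠ i} k) - C (a j))) ^ (m + 1))
    {gst : MvPolynomial {j : Fin 3 // j ≠ i} k}
    (hgst : (X p : MvPolynomial {j : Fin 3 // j ≠ i} k) ^ m * gst =
      aeval (fun j => if j = p then (X p : MvPolynomial {j : Fin 3 // j ≠ i} k) else X p * X j)
        (aeval (fun l => (X l : MvPolynomial {j : Fin 3 // j ≠ i} k) + C (a l)) (dehomogenize i g))) :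
    gst ≠ 0 ∧ ¬ X p ∣ gst ∧ Squarefree gst := by
  classical
  -- exact order at `a` = exact order of the shift at the origin
  have hshift : aeval (fun l => (X l : MvPolynomial {j : Fin 3 // j ≠ i} k) + C (a l)) (dehomogenize i g) ∉
      idealOfVars {j : Fin 3 // j ≠ i} k ^ (m + 1) := by
    intro h
    apply hexact
    rw [mem_pow_span_X_sub_C_iff]
    exact (mem_pow_idealOfVars_iff' _ _).mp h
  have hX : ¬ X p ∣ gst := not_X_dvd_of_not_mem_pow_succ p hshift hgst
  refine ⟨fun h => hX (h ▸ dvd_zero _), hX, ?_⟩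
  exact squarefree_of_aeval_blowupSubst_eq p (squarefree_aeval_X_add_C a hsq) hgst.symm hX

/-- **T-ΔLIFT-CLUSTER-SQF — `hfinst` of T-CLUSTER-LIFT part 9 discharged**: with the data of `squarefree_strictTransform_shift`, the primes
`𝔮 ∋ gst` with `gst ∈ 𝔪_𝔮²` are finitely many (res-type-032 `finite_setOf_mem_sq_chart`, p516860). [cite: Matsumura1987, Thm. 14.2]
[OURS · L1 W4.5b] -/
theorem finite_setOf_mem_sq_strictTransform_shift (i : Fin 3) (a : {j : Fin 3 // j ≠ i} → k) (p : {j : Fin 3 // j ≠ i}) {m : ℕ}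
    {g : MvPolynomial (Fin 3) k} (hsq : Squarefree (dehomogenize i g))
    (hexact : dehomogenize i g ∉
      (Ideal.span (Set.range fun j => (X j : MvPolynomial {j : Fin 3 // j ≠ i} k) - C (a j))) ^ (m + 1))
    {gst : MvPolynomial {j : Fin 3 // j ≠ i} k}
    (hgst : (X p : MvPolynomial {j : Fin 3 // j ≠ i} k) ^ m * gst =
      aeval (fun j => if j = p then (X p : MvPolynomial {j : Fin 3 // j ≠ i} k) else X p * X j)
        (aeval (fun l => (X l : MvPolynomial {j : Fin 3 // j ≠ i} k) + C (a l)) (dehomogenize i g))) :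
    {𝔮 : PrimeSpectrum (MvPolynomial {j : Fin 3 // j ≠ i} k) | gst ∈ 𝔮.asIdeal ∧
      algebraMap (MvPolynomial {j : Fin 3 // j ≠ i} k) (Localization.AtPrime 𝔮.asIdeal) gst ∈
        maximalIdeal (Localization.AtPrime 𝔮.asIdeal) ^ 2}.Finite :=
  have h := squarefree_strictTransform_shift i a p hsq hexact hgst
  finite_setOf_mem_sq_chart i h.1 h.2.2

/-- **The same from the RADICAL spelling** of `ReducedConeForm` (R2): `(g(T_i := 1))` a radical ideal (res-L1-w45b-stub-2 / res-type-097
currency; square-free by Mathlib `isRadical_iff_span_singleton`, non-zero because `∉ 𝔪_a^{m+1}`). [cite: Matsumura1987, Thm. 14.2] [OURS · L1 W4.5b] -/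
theorem finite_setOf_mem_sq_strictTransform_shift_of_isRadical (i : Fin 3) (a : {j : Fin 3 // j ≠ i} → k)
    (p : {j : Fin 3 // j ≠ i}) {m : ℕ} {g : MvPolynomial (Fin 3) k}
    (hrad : (Ideal.span {dehomogenize i g} : Ideal (MvPolynomial {j : Fin 3 // j ≠ i} k)).IsRadical)
    (hexact : dehomogenize i g ∉
      (Ideal.span (Set.range fun j => (X j : MvPolynomial {j : Fin 3 // j ≠ i} k) - C (a j))) ^ (m + 1))
    {gst : MvPolynomial {j : Fin 3 // j ≠ i} k}
    (hgst : (X p : MvPolynomial {j : Fin 3 // j ≠ i} k) ^ m * gst =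
      aeval (fun j => if j = p then (X p : MvPolynomial {j : Fin 3 // j ≠ i} k) else X p * X j)
        (aeval (fun l => (X l : MvPolynomial {j : Fin 3 // j ≠ i} k) + C (a l)) (dehomogenize i g))) :
    {𝔮 : PrimeSpectrum (MvPolynomial {j : Fin 3 // j ≠ i} k) | gst ∈ 𝔮.asIdeal ∧
      algebraMap (MvPolynomial {j : Fin 3 // j ≠ i} k) (Localization.AtPrime 𝔮.asIdeal) gst ∈
        maximalIdeal (Localization.AtPrime 𝔮.asIdeal) ^ 2}.Finite := by
  have hne : dehomogenize i g ≠ 0 := fun h => hexact (h ▸ Ideal.zero_mem _)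
  exact finite_setOf_mem_sq_strictTransform_shift i a p (((isRadical_iff_span_singleton).mpr hrad).squarefree hne) hexact hgst

end General

end Summit.ResolutionOfSingularities.ResolutionOfSingularities.Cruxes.EquisingularLiftNat.Sections

end
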